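import Summits.ResolutionOfSingularities.ResolutionOfSingularities.Theorems.FrobeniusLadderFInjectiveMacaulayficationFullLastCentreBedCInstance
import Summits.ResolutionOfSingularities.ResolutionOfSingularities.Theorems.FrobeniusLadderFInjectiveMacaulayficationFullLastCentreResidual
import Summits.ResolutionOfSingularities.ResolutionOfSingularities.Theorems.FrobeniusLadderFInjectiveMacaulayficationFullLastCentreAxisOrder
import HarnessLib

/-!
# THE EXACT ONE-STEP LAW AT THE DOORʼS COUNTEREXAMPLE: `ρ′ = 6` EXACTLY (MC-8ᶜʼs cap 8 holds there with margin 2) WHILE THE CONE-INITIAL ORDER IS EXACTLY 11 — kernel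
# (crux `FInjectiveMacaulayfication` stmt-ResolutionOfSingularities-15315, chain w45a; res-L1-w45a-plan-1 R25.41 (iii) «state when it is an equality» / R26.1; the instance = ✓ `…FullLastCentreBedCInstance`
# (res-L1-w45a-stub-1 g17, data = res-L1-w45a-tri-2 g23 dump b752767d37e69ff0); the law = res-L1-w45a-lead-1 g16 ✓p729098 `LastCentreAxisOrder.ordLE_iff` + ✓p729821 `LastCentreResidual.exists_isResidual`;
# seat res-L1-w45a-stub-1 g17)

[OURS · L1 W4.5a] Support file (`--supports stmt-ResolutionOfSingularities-15315 --as helper`); theorems only, no definitions, no named fact; NOT a statement of any manuscript; nothing of the crux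
is proved. It upgrades the «honest scope» clause of the kernel negative from evidence to kernel level: at bed cʼs canonical surface centre `Π₂` (stage `S`, centre `Nor = {t′, y₄″}`, chart letter
`L = t′`, new stage `S′`, residual `Disc_x(S) = t′⁴·N₂`):
* §1 the minimal normal degree of `N₂` along `Π₂` is `ν = 2` (attained by `t′²ỹ₂¹⁷`);
* §2 the CONE-INITIAL order read at `x′` is EXACTLY `11` (`AxisOrdLE … 11 ∧ ¬ AxisOrdLE … 10`: the normal-degree-2 monomials are `t′²ỹ₂^k`, `k = 11…18`) — so the cut (LC) fails for every bound `≤ 10`,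
  not only for the doorʼs `8`;
* §3 `Disc_x(S′) ≠ 0`, hence residual decompositions `Disc_x(S′) = y^{α′}·N′` exist (✓ `exists_isResidual`);
* §4 ★★★ for EVERY residual decomposition of `Disc_x(S′)`: `ord₀ N′ ≤ 6` and `¬ ord₀ N′ ≤ 5`, i.e. **`ρ′ = 6`**, by the exact law ✓ `ordLE_iff` (`ρ′ = min_e [(|e| − e_L) + (ndeg e − ν)]`, minimum
  realised by `7·t′³ỹ₃⁵` in graded piece `ndeg = ν + 1`, and `e₀ + e₁ + e₂ + 2e₃ ≥ 8` on all 235 monomials) — the conjecture of recordʼs inequality `ρ′ ≤ 8` HOLDS at the very instance that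
  refutes the typed door, with margin 2 (`door_vs_law`).
All list-level facts are `decide`/`decide +kernel` checks on the in-tree term list `N2L`. AI-written (AI review is weaker than expert review). [folklore computation]
-/

-- single-problem summit: the doubled namespace component is forced
set_option linter.dupNamespace false

noncomputable section

open MvPolynomial Finsupp

namespace Summit.ResolutionOfSingularities.ResolutionOfSingularities.Theorems.FInjectiveMacaulayfication.LastCentreBedC

open Summit.ResolutionOfSingularities.ResolutionOfSingularities.Theorems.FInjectiveMacaulayfication LastCentreDefs KLocCellKit LastCentreKit

variable (K : Type) [Field K]

/-! ## §1 The minimal normal degree of `N₂` along `Π₂` is `ν = 2` -/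

/-- `ν = 2` is attained: `t′²ỹ₂¹⁷ ∈ supp N₂` (coefficient `4 ≢ 0 mod 11`) has normal degree `2`. [OURS · certificate] -/
theorem nu_attained [CharP K 11] : ∃ e ∈ (N K).support, norDeg Nor e = 2 :=
  ⟨_, mem_support_evalL_of_not_dvd 11 N2L (![2, 17, 0, 0] : Fin 4 → ℕ) (by decide), by rw [norDeg_nor]; simp⟩

/-- Every monomial of `N₂` has normal degree `≥ 2` along `Π₂` (list check). [OURS · certificate] -/
theorem nu_le : ∀ e ∈ (N K).support, 2 ≤ norDeg Nor e := by
  intro e he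
  rw [norDeg_nor]
  exact forall_support_of_list (K := K) N2L (fun v => 2 ≤ v 0 + v 3) (by decide +kernel) e he

/-! ## §2 The cone-initial order at `x′` is exactly `11` -/

/-- `AxisOrdLE Nor L N₂ 11`: the normal-degree-2 monomial `t′²ỹ₂¹¹` (coefficient `6`) has `|e| − e_{t′} = 11`. [OURS · certificate] -/
theorem axisOrdLE_eleven [CharP K 11] : AxisOrdLE Nor L (N K) 11 := by
  refine ⟨_, mem_support_evalL_of_not_dvd 11 N2L (![2, 11, 0, 0] : Fin 4 → ℕ) (by decide), fun e₁ he₁ => ?_, ?_⟩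
  · have h := nu_le K e₁ he₁
    rw [norDeg_nor] at h ⊢
    rw [norDeg_nor]
    simpa using h
  · rw [tdeg_eq, L]
    simp

/-- `¬ AxisOrdLE Nor L N₂ 10`: every monomial of minimal normal degree `2` is `t′²ỹ₂^k` with `k ≥ 11`, so `|e| − e_{t′} ≥ 11 > 10` (list check) — the cut (LC) overshoots by `3` at this
instance, not by a hair. [OURS · certificate] -/
theorem not_axisOrdLE_ten [CharP K 11] : ¬ AxisOrdLE Nor L (N K) 10 := by
  rintro ⟨e, he, hmin, hle⟩
  have hw : Finsupp.equivFunOnFinite.symm (![2, 17, 0, 0] : Fin 4 → ℕ) ∈ (N K).support :=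
    mem_support_evalL_of_not_dvd 11 N2L _ (by decide)
  have h1 := hmin _ hw
  rw [norDeg_nor, norDeg_nor] at h1
  simp only [Finsupp.coe_equivFunOnFinite_symm, Matrix.cons_val_zero] at h1
  have h1' : e 0 + e 3 ≤ 2 := by simpa using h1
  rw [tdeg_eq, L] at hle
  have h := forall_support_of_list (K := K) N2L (fun v => v 0 + v 3 ≤ 2 → 10 + v 0 < v 0 + v 1 + v 2 + v 3) (by decide +kernel) e he h1'
  omega

/-! ## §3 `Disc_x(S′) ≠ 0`; residual decompositions of it exist -/

/-- `N₂ ≠ 0` (`y₄″⁸ ∈ supp N₂`). [plumbing] -/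
theorem N_ne_zero [CharP K 11] : N K ≠ 0 := by
  intro h
  have hw := mem_support_evalL_of_not_dvd (K := K) 11 N2L (![0, 0, 0, 8] : Fin 4 → ℕ) (by decide)
  rw [show evalL K N2L = N K from rfl, h, MvPolynomial.support_zero] at hw
  simp at hw

/-- `Disc_x(S) = t′⁴·N₂ ≠ 0`. [plumbing] -/
theorem D_ne_zero [CharP K 11] : (S K).D ≠ 0 := by
  rw [(isResidual K).1]
  exact mul_ne_zero (MvPolynomial.monomial_eq_zero.not.mpr one_ne_zero) (N_ne_zero K)

/-- `Disc_x(S′) ≠ 0`: `σ_L(Disc_x S) = t′⁶·Disc_x S′` (✓ `disc_chart`) and `σ_L` is injective on coefficients (✓ `coeff_tau_chartMap`). [plumbing] -/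
theorem D'_ne_zero [CharP K 11] : (S' K).D ≠ 0 := by
  intro h0
  have hc := LastCentreAxisOrder.disc_chart (isChart K)
  rw [h0, mul_zero] at hc
  apply D_ne_zero K
  ext e
  rw [← LastCentreAxisOrder.coeff_tau_chartMap Nor L (S K).D e, hc, coeff_zero, coeff_zero]

/-- Residual decompositions `Disc_x(S′) = y^{α′}·N′` w.r.t. `Exc′ = {t′}` exist (✓ `exists_isResidual`, res-L1-w45a-lead-1). [plumbing] -/
theorem exists_isResidual' [CharP K 11] : ∃ (α' : Expo) (N' : YPoly K), IsResidual (S' K).Exc (S' K).D α' N' :=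
  LastCentreResidual.exists_isResidual _ _ (D'_ne_zero K)

/-! ## §4 ★★★ The exact law at the instance: `ρ′ = 6` -/

/-- `ρ′ ≤ 6`: by the exact law ✓ `ordLE_iff` it suffices to exhibit `e ∈ supp N₂` with `|e| + ndeg e ≤ 6 + e_{t′} + ν`; `7·t′³ỹ₃⁵` does it (`8 + 3 = 6 + 3 + 2`). [OURS · certificate on ✓p729098] -/
theorem rho'_le_six [CharP K 11] {α' : Expo} {N' : YPoly K} (hN' : IsResidual (S' K).Exc (S' K).D α' N') : OrdLE N' 6 := by
  rw [LastCentreAxisOrder.ordLE_iff nor_facts.2.2 (isChart K) (isResidual K) hN' (nu_attained K) (nu_le K) 6]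
  refine ⟨_, mem_support_evalL_of_not_dvd 11 N2L (![3, 0, 5, 0] : Fin 4 → ℕ) (by decide), ?_⟩
  rw [tdeg_eq, norDeg_nor, L]
  simp

/-- `¬ ρ′ ≤ 5`: by ✓ `ordLE_iff`, this is `|e| + ndeg e > 5 + e_{t′} + 2`, i.e. `e₀ + e₁ + e₂ + 2e₃ ≥ 8`, on every monomial of `N₂` (list check over the 235 terms). [OURS · certificate on ✓p729098] -/
theorem not_rho'_le_five [CharP K 11] {α' : Expo} {N' : YPoly K} (hN' : IsResidual (S' K).Exc (S' K).D α' N') : ¬ OrdLE N' 5 := by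
  rw [LastCentreAxisOrder.ordLE_iff nor_facts.2.2 (isChart K) (isResidual K) hN' (nu_attained K) (nu_le K) 5]
  rintro ⟨e, he, hle⟩
  rw [tdeg_eq, norDeg_nor, L] at hle
  have h := forall_support_of_list (K := K) N2L (fun v => 5 + v 0 + 2 < v 0 + v 1 + v 2 + v 3 + (v 0 + v 3)) (by decide +kernel) e he
  omega

/-- ★★★ **`ρ′ = 6` AT THE DOORʼS COUNTEREXAMPLE**: residual decompositions of `Disc_x(S′)` exist, and for EVERY one of them `ord₀ N′ ≤ 6 ∧ ¬ ord₀ N′ ≤ 5` — the conjecture of recordʼs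
one-step inequality `ρ′ ≤ 8` holds with margin `2` at the instance that refutes the typed door `LastCentreConeBound CoordCanonical`. [OURS · kernel; R25.41 (iii)] -/
theorem rho'_eq_six [CharP K 11] :
    (∃ (α' : Expo) (N' : YPoly K), IsResidual (S' K).Exc (S' K).D α' N') ∧
      ∀ (α' : Expo) (N' : YPoly K), IsResidual (S' K).Exc (S' K).D α' N' → OrdLE N' 6 ∧ ¬ OrdLE N' 5 :=
  ⟨exists_isResidual' K, fun _ _ h => ⟨rho'_le_six K h, not_rho'_le_five K h⟩⟩

/-- ★★★ **DOOR VERSUS LAW IN ONE SENTENCE** (bed c, `Π₂`, every field of characteristic 11): the cone-initial order at `x′` is EXACTLY `11` — so the cut (LC) `AxisOrdLE Nor L N m` is false for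
every `m ≤ 10`, in particular for the doorʼs `m = 8` — while the TRUE residual order is `ρ′ = 6 ≤ 8`: the door dies, MC-8ᶜʼs inequality does not. [OURS · kernel; R25.41 (iii) / R26.1] -/
theorem door_vs_law [CharP K 11] :
    (AxisOrdLE Nor L (N K) 11 ∧ ¬ AxisOrdLE Nor L (N K) 10 ∧ ¬ AxisOrdLE Nor L (N K) 8) ∧
      ∀ (α' : Expo) (N' : YPoly K), IsResidual (S' K).Exc (S' K).D α' N' → OrdLE N' 6 ∧ ¬ OrdLE N' 5 :=
  ⟨⟨axisOrdLE_eleven K, not_axisOrdLE_ten K, not_axisOrdLE K⟩, (rho'_eq_six K).2⟩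

end Summit.ResolutionOfSingularities.ResolutionOfSingularities.Theorems.FInjectiveMacaulayfication.LastCentreBedC

end
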